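import Mathlib
import HarnessLib
import Summits.PneNP.PneNP.Theorems.CnfIdealGenLengthFregeShortensGenLengthRepr

/-!
# `FregeShortensGenLength` (stmt-PneNP-18886) — Part B: translated formulas are Boolean-like modulo few terms

For every propositional formula `B` (standard leaves `x_i ↦ 1 - x_i`), in `R⟨x_0, …, x_{n-1}⟩`:
* `[x_i, tr B]` is a sum of `≤ size B` single terms `u · g · v` (`g` a commutator axiom) of cofactor degree
  `≤ size B` (`repr_comm_X`); `[tr B, tr C]` needs `≤ size B · size C` terms of degree `≤ size B + size C`
  (`repr_comm`);
* the idempotency defect `tr B · tr B - tr B` needs `≤ (size B)²` terms of degree `≤ 2 size B` (`repr_bool`):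
  at a leaf it IS a Boolean axiom, and `ghgh - gh = g [h, g] h + (g² - g) h² + g (h² - h)`.
These are the few-term analogues of the Li–Tzameret–Wang lemma that `tr(B)(1 - tr B)` has short
non-commutative IPS proofs [LiTzameretWang2018, §4]; all identities are checked by `noncomm_ring`.
-/

set_option linter.dupNamespace false -- `Summit.PneNP.PneNP.…`: summit = sub-problem name (D-0017)

/-! ## Part B — translated formulas are Boolean-like modulo few terms -/

namespace Summit.PneNP.PneNP.Theorems.CnfIdealGenLength

open Literature.Computability.Complexity
open Literature.Computability.MetaComplexity
open Literature.Computability.MetaComplexity.NCIPS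

noncomputable section

variable {R : Type*} [CommRing R] {n : ℕ}

/-- Commutator of a letter with a translated formula: `[x_i, tr B]` is a sum of at most `size B` single
terms of cofactor degree `≤ size B` (expand the derivation `[x_i, ·]` along the formula; at a leaf it is a
commutator axiom or `0`). [folklore] -/
theorem repr_comm_X (i : Fin n) (B : PropForm ℕ) :
    Repr R B.size B.size (X R i * trForm (stdLeaf R n) B - trForm (stdLeaf R n) B * X R i) := by
  induction B with
  | var j =>
    simp only [trForm_var, PropForm.size]
    unfold stdLeaf
    split_ifs with hj
    · by_cases hij : (⟨j, hj⟩ : Fin n) = i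
      · subst hij
        exact Repr.zero.congr (by noncomm_ring)
      · exact (Repr.of_isAxiom (E := 1) (Or.inr ⟨⟨j, hj⟩, i, hij, rfl⟩) le_rfl).congr (by noncomm_ring)
    · exact Repr.zero.congr (by noncomm_ring)
  | const b =>
    cases b <;> simp only [trForm_const, PropForm.size] <;> exact Repr.zero.congr (by simp)
  | neg B ih =>
    simp only [trForm_neg, PropForm.size]
    exact (ih.neg.congr (by noncomm_ring)).mono (by omega) (by omega)
  | conj B C ihB ihC =>
    simp only [trForm_conj, PropForm.size]
    have hB := wordDeg_trForm_stdLeaf_le (R := R) (n := n) B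
    have hC := wordDeg_trForm_stdLeaf_le (R := R) (n := n) C
    refine (((ihB.mul_right (wordDeg_one_sub_le hC)).add
      ((ihC.mul_left (wordDeg_one_sub_le hB)).mono (le_of_eq (by ring)) le_rfl)).congr
      (by noncomm_ring)).mono (by omega) (by omega)
  | disj B C ihB ihC =>
    simp only [trForm_disj, PropForm.size]
    have hB := wordDeg_trForm_stdLeaf_le (R := R) (n := n) B
    have hC := wordDeg_trForm_stdLeaf_le (R := R) (n := n) C
    refine (((ihB.mul_right hC).add ((ihC.mul_left hB).mono (le_of_eq (by ring)) le_rfl)).congr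
      (by noncomm_ring)).mono (by omega) (by omega)

/-- Commutator of two translated formulas: `[tr B, tr C]` is a sum of at most `size B · size C` single
terms of cofactor degree `≤ size B + size C`. [folklore] -/
theorem repr_comm (B C : PropForm ℕ) :
    Repr R (B.size + C.size) (B.size * C.size)
      (trForm (stdLeaf R n) B * trForm (stdLeaf R n) C - trForm (stdLeaf R n) C * trForm (stdLeaf R n) B) := by
  induction B with
  | var j =>
    simp only [trForm_var, PropForm.size]
    by_cases hj : j < n
    · have h := (repr_comm_X (R := R) ⟨j, hj⟩ C).neg
      rw [stdLeaf, dif_pos hj]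
      exact (h.congr (by noncomm_ring)).mono (by omega) (by simp)
    · rw [stdLeaf, dif_neg hj]
      exact Repr.zero.congr (by noncomm_ring)
  | const b =>
    cases b <;> simp only [trForm_const, PropForm.size] <;> exact Repr.zero.congr (by simp)
  | neg B ih =>
    simp only [trForm_neg, PropForm.size]
    exact (ih.neg.congr (by noncomm_ring)).mono (by omega) (Nat.mul_le_mul_right _ (by omega))
  | conj B B' ih ih' =>
    simp only [trForm_conj, PropForm.size]
    have hB := wordDeg_trForm_stdLeaf_le (R := R) (n := n) B
    have hB' := wordDeg_trForm_stdLeaf_le (R := R) (n := n) B'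
    have h1 := (ih'.mul_left (wordDeg_one_sub_le hB)).mono
      (show B.size + (B'.size + C.size) ≤ B.size + B'.size + C.size by omega) le_rfl
    have h2 := (ih.mul_right (wordDeg_one_sub_le hB')).mono
      (show B.size + C.size + B'.size ≤ B.size + B'.size + C.size by omega) le_rfl
    refine ((h1.add h2).congr (by noncomm_ring)).mono (by omega) ?_
    nlinarith [Nat.zero_le C.size]
  | disj B B' ih ih' =>
    simp only [trForm_disj, PropForm.size]
    have hB := wordDeg_trForm_stdLeaf_le (R := R) (n := n) B
    have hB' := wordDeg_trForm_stdLeaf_le (R := R) (n := n) B'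
    have h1 := (ih'.mul_left hB).mono
      (show B.size + (B'.size + C.size) ≤ B.size + B'.size + C.size by omega) le_rfl
    have h2 := (ih.mul_right hB').mono
      (show B.size + C.size + B'.size ≤ B.size + B'.size + C.size by omega) le_rfl
    refine ((h1.add h2).congr (by noncomm_ring)).mono (by omega) ?_
    nlinarith [Nat.zero_le C.size]

/-- Idempotency defect of a translated formula: `tr B · tr B - tr B` is a sum of at most `size B ^ 2`
single terms of cofactor degree `≤ 2 · size B` (at a leaf it is a Boolean axiom; a product `g h` uses
`ghgh - gh = g [h, g] h + (g² - g) h² + g (h² - h)`). [folklore] -/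
theorem repr_bool (B : PropForm ℕ) :
    Repr R (2 * B.size) (B.size ^ 2)
      (trForm (stdLeaf R n) B * trForm (stdLeaf R n) B - trForm (stdLeaf R n) B) := by
  induction B with
  | var j =>
    simp only [trForm_var, PropForm.size]
    by_cases hj : j < n
    · rw [stdLeaf, dif_pos hj]
      exact (Repr.of_isAxiom (E := 2) (Or.inl ⟨⟨j, hj⟩, rfl⟩) le_rfl).congr (by noncomm_ring)
    · rw [stdLeaf, dif_neg hj]
      exact Repr.zero.congr (by noncomm_ring)
  | const b =>
    cases b <;> simp only [trForm_const, PropForm.size] <;> exact Repr.zero.congr (by simp)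
  | neg B ih =>
    simp only [trForm_neg, PropForm.size]
    exact (ih.congr (by noncomm_ring)).mono (by omega) (Nat.pow_le_pow_left (Nat.le_succ _) 2)
  | conj B C ihB ihC =>
    simp only [trForm_conj, PropForm.size]
    have hB := wordDeg_trForm_stdLeaf_le (R := R) (n := n) B
    have hC := wordDeg_trForm_stdLeaf_le (R := R) (n := n) C
    have h1 := (((repr_comm (R := R) (n := n) C B).mul_left (wordDeg_one_sub_le hB)).mul_right
      (wordDeg_one_sub_le hC)).mono
      (show B.size + (C.size + B.size) + C.size ≤ 2 * B.size + 2 * C.size by omega) le_rfl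
    have h2 := (ihB.mul_right (wordDeg_mul_le_of_le (wordDeg_one_sub_le hC) (wordDeg_one_sub_le hC))).mono
      (show 2 * B.size + (C.size + C.size) ≤ 2 * B.size + 2 * C.size by omega) le_rfl
    have h3 := (ihC.mul_left (wordDeg_one_sub_le hB)).mono
      (show B.size + 2 * C.size ≤ 2 * B.size + 2 * C.size by omega) le_rfl
    refine (((h1.add h2).add h3).congr (by noncomm_ring)).mono (by omega) ?_
    nlinarith [Nat.zero_le B.size, Nat.zero_le C.size]
  | disj B C ihB ihC =>
    simp only [trForm_disj, PropForm.size]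
    have hB := wordDeg_trForm_stdLeaf_le (R := R) (n := n) B
    have hC := wordDeg_trForm_stdLeaf_le (R := R) (n := n) C
    have h1 := (((repr_comm (R := R) (n := n) C B).mul_left hB).mul_right hC).mono
      (show B.size + (C.size + B.size) + C.size ≤ 2 * B.size + 2 * C.size by omega) le_rfl
    have h2 := (ihB.mul_right (wordDeg_mul_le_of_le hC hC)).mono
      (show 2 * B.size + (C.size + C.size) ≤ 2 * B.size + 2 * C.size by omega) le_rfl
    have h3 := (ihC.mul_left hB).mono
      (show B.size + 2 * C.size ≤ 2 * B.size + 2 * C.size by omega) le_rfl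
    refine (((h1.add h2).add h3).congr (by noncomm_ring)).mono (by omega) ?_
    nlinarith [Nat.zero_le B.size, Nat.zero_le C.size]

end

end Summit.PneNP.PneNP.Theorems.CnfIdealGenLength
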